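import Summits.HodgeConjecture.CorCM.MultiFieldWeilNonIsomorphicSimpleFamilies
import Summits.HodgeConjecture.CorCM.MultiFieldWeilSurfaceBlockClosures
import HarnessLib

/-!
# MULTI-FIELD WEIL ENGINE — GROUPS OF SIMPLE CM THREEFOLDS THROUGH ONE IMAGINARY QUADRATIC FIELD, PAIRWISE OUTSIDE EACH OTHER'S GALOIS CLOSURES, AS BLOCKS: any number of such
# groups, pairwise SEPARATED, with simple CM surfaces up to the dihedral-triple limit and any CM elliptic curves — the Hodge conjecture for every product of copies, given ONLY
# Markman's fourfold theorem

Cell `pub-hodgecm2` (COR-CM), seat b30 gen 35 (2026-08-25); count-neutral own lane MULTI-FIELD WEIL ENGINE (stem `MultiFieldWeil*`); joins the two halves of gen 35: the SPLITTING along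
separated threefold blocks (`CorCM/MultiFieldWeilSeparatedThreefoldBlocks.lean`, unconditional) and the NO-TOWER engine (`CorCM/MultiFieldWeilNonIsomorphicSimpleFamilies.lean`).  Theorems
only; no definition, no named fact, no `sorry`.  HONEST FRAMING: conditional on the displayed Markman fourfold binder only; `HC_CM` is NOT proved and not asserted.

* §1 **`hodgeConjectureFor_prod_groupBlock_of_outside_closures`** — THE GROUP BLOCK: in a uniform family `A_i ⊨ (K_i; Φ_i)` of simple CM abelian varieties, a group `e : Fin r → I` of
  SEXTIC slots whose fields contain one imaginary quadratic field `k` (`i m : k ↪ K_{e m}`) and lie pairwise outside each other's Galois closures (`hout`, relative to an embedding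
  `τ : k → ℂ`); a product of copies every member of which is a group threefold or a CM elliptic curve whose field embeds in a group field (hence is `≅ k`: such a curve is isogenous
  to the CM curve `E ⊨ (k; {τ})`).  Then the Hodge conjecture holds for it, mod Markman 4 (the product is isogenous to a product of copies of `Fin.cons E (A ∘ e)`, an engine family
  over the fields `Option.elim · k K`; `hodgeConjectureFor_biproduct_comp_of_simpleThreefolds_of_outside_closures`).
* §2 **`hodgeConjectureFor_prod_of_separatedGroups_of_outside_closures`** — labels `b : I → C`; the sextic slots of each label `c` form such a group over `k_c` (enumeration `e_c`,
  `hcov`); differently labelled sextic slots SEPARATED (different Galois closures, no common imaginary quadratic subfield); (iii′) no dihedral surface triple; any quadratic slots: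
  the Hodge conjecture for EVERY product of copies `⨁_j A_{π j}` (`hodgeConjectureFor_prod_of_separatedLabels` + §1 + `hodgeConjectureFor_prod_surfaceBlock_of_closures`).  This
  supersedes `CorCM/MultiFieldWeilSeparatedTowerBlocks.lean` (towers ⟹ pairwise outside closures) and `…SeparatedThreefoldPairsAnyCurves.lean` for pairs of NON-isomorphic fields.

[cite: MoonenZarhin1999LowDim, Thm. (0.1), Thm. (0.2), §3 (3.1), Cor. (3.9), §5 (5.2)] [cite: Markman2025SurveySecant, Thm. 1.2] [cite: Gordon1999HodgeAVSurvey, §3 Theorem (proof), 7.4–7.7, 10.10]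
[cite: Shimura1998, §6.1 Corollary of Theorem 2 (p. 41), §8.2 Prop. 26, §18.2 Lemma (i)] [cite: Lang2002, VI §1 Thm. 1.1 and Cor. 1.6] [cite: MumfordAV1970, §19 Thm. 1 and p. 169]

## References
* [MoonenZarhin1999LowDim] B. Moonen, Yu. Zarhin, Math. Ann. 315 (1999) 711–733.  [Markman2025SurveySecant] E. Markman, arXiv:2509.23403, Thm. 1.2.  [Gordon1999HodgeAVSurvey]
  B. B. Gordon, *A survey of the Hodge conjecture for abelian varieties*, §3, 7.4–7.7, 10.10.  [Shimura1998] G. Shimura, *Abelian varieties with complex multiplication and modular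
  functions*, §6.1, §8.2, §18.2.  [Lang2002] S. Lang, *Algebra*, GTM 211, VI §1.  [MumfordAV1970] D. Mumford, *Abelian Varieties*, §19.
-/

noncomputable section

open CategoryTheory CategoryTheory.Limits NumberField IntermediateField

namespace Summit.HodgeConjecture.CorCM.MultiFieldWeil

open Finset
open Literature.AlgebraicGeometry Literature.AlgebraicGeometry.Motives Literature.AlgebraicGeometry.HodgeTheory
open Literature.AlgebraicGeometry.ComplexMultiplication (IsCMTypeRealisation)
open Literature.AlgebraicTopology.SingularHomology
open Literature.NumberTheory.ComplexMultiplication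
open Literature.AlgebraicGeometry.Pohlmann1968

open scoped Classical

section Family

variable {I : Type} [Fintype I] {K : I → Type} [fK : ∀ i, Field (K i)] [nK : ∀ i, NumberField (K i)] [cK : ∀ i, IsCMField (K i)]
  {Φ : ∀ i, CMType (K i)} {A : I → AbelianVariety ℂ} {ι : ∀ i, 𝓞 (K i) →+* End (A i)} {θ : ∀ i, K i →+* Module.End ℂ (complexBetti (A i).X 1)}
  {C : Type}

omit [Fintype I] cK in
/-- The CM field of a realisation of dimension `≤ 3` has degree `2`, `4` or `6`. [cite: Shimura1998, §5.2] -/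
private theorem finrank_eq_or_of_dim_le_three₃₅g (hA : ∀ i, IsCMTypeRealisation (Φ i) (A i) (ι i) (θ i)) {i : I} (h3 : (A i).dim ≤ 3) :
    Module.finrank ℚ (K i) = 2 ∨ Module.finrank ℚ (K i) = 4 ∨ Module.finrank ℚ (K i) = 6 := by
  have h := finrank_eq_two_mul_dim_of_isCMTypeRealisation (hA i)
  have hpos : 0 < Module.finrank ℚ (K i) := Module.finrank_pos
  interval_cases hd : (A i).dim <;> omega

omit [Fintype I] cK in
/-- An embedding of number fields `K_i ↪ K_t` makes `[K_i : ℚ]` divide `[K_t : ℚ]`. [cite: Shimura1998, §8.1] -/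
private theorem finrank_dvd_of_ringHom₃₅g {i t : I} (g : K i →+* K t) : Module.finrank ℚ (K i) ∣ Module.finrank ℚ (K t) := by
  have h1 : Module.finrank ℚ ↥g.toRatAlgHom.fieldRange = Module.finrank ℚ (K i) :=
    ((AlgEquiv.ofInjectiveField g.toRatAlgHom).toLinearEquiv.finrank_eq).symm
  rw [← h1, ← IntermediateField.finrank_top' (F := ℚ) (E := K t)]
  exact IntermediateField.finrank_dvd_of_le_right le_top

/-! ## §1 The group block -/

omit [Fintype I] in
/-- **THE GROUP BLOCK.**  `A_i ⊨ (K_i; Φ_i)` simple; `e : Fin r → I` SEXTIC slots whose fields contain the imaginary quadratic field `k` (`i m : k ↪ K_{e m}`), pairwise outside each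
other's Galois closures along the `τ`-embeddings (`hout`); a product of copies `⨁_l A_{ρ l}` every member of which is some `A_{e m}` or a CM elliptic curve whose field embeds in some
`K_{e m}`.  Then the Hodge conjecture holds for it, GIVEN ONLY Markman's fourfold theorem: every such curve is isogenous to the CM elliptic curve `E ⊨ (k; {τ})` (a sextic field has one
quadratic subfield), so the product is isogenous to a product of copies of the engine family `Fin.cons E (A ∘ e)` over the fields `Option.elim · k K`, settled by
`hodgeConjectureFor_biproduct_comp_of_simpleThreefolds_of_outside_closures`. [cite: Markman2025SurveySecant, Thm. 1.2] [cite: Shimura1998, §6.1 Corollary of Theorem 2, §18.2 Lemma (i)] -/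
theorem hodgeConjectureFor_prod_groupBlock_of_outside_closures (hW4 : Markman2025_weilClasses_algebraic_abelianFourfold)
    (hA : ∀ i, IsCMTypeRealisation (Φ i) (A i) (ι i) (θ i)) (hS : ∀ i, (A i).IsSimple) {r : ℕ} (e : Fin r → I) (h6 : ∀ m, Module.finrank ℚ (K (e m)) = 6)
    {k : Type} [fk : Field k] [nk : NumberField k] [ck : IsCMField k] (h2 : Module.finrank ℚ k = 2) (i : ∀ m, k →+* K (e m)) (τ : k →+* ℂ)
    (hout : ∀ m₀ m : Fin r, m₀ ≠ m → ∀ s : K (e m) →+* ℂ, s.comp (i m) = τ → ∃ x, s x ∉ normalClosure ℚ (K (e m₀)) ℂ)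
    {M : ℕ} (ρ : Fin M → I) (hρ : ∀ l, (Module.finrank ℚ (K (ρ l)) = 2 ∧ ∃ m, Nonempty (K (ρ l) →+* K (e m))) ∨ ∃ m, ρ l = e m) :
    HodgeConjectureFor (⨁ fun l => A (ρ l)).dim (⨁ fun l => A (ρ l)).X := by
  -- the CM elliptic curve of `k`
  obtain ⟨Ψ, E, ιE, θE, hE, hΨ⟩ := exists_cmCurve_iff_eq h2 τ
  -- every curve member is isogenous to `E`
  have hcurve : ∀ l, (Module.finrank ℚ (K (ρ l)) = 2 ∧ ∃ m, Nonempty (K (ρ l) →+* K (e m))) → AbelianVariety.IsIsogenous (A (ρ l)) E := by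
    rintro l ⟨h2l, m, ⟨g⟩⟩
    obtain ⟨φ⟩ := WeilFibre.nonempty_algEquiv_of_finrank_eq_two (M := K (e m)) h2l h2 (by rw [h6 m]; decide) g.toRatAlgHom (i m).toRatAlgHom
    exact isIsogenous_of_ringEquiv h2l (hA (ρ l)) hE φ.symm.toRingEquiv
  -- the engine family `Fin.cons E (A ∘ e)` over the fields `Option.elim · k K`
  let Kf : Option I → Type := fun o => o.elim k K
  letI instF : ∀ o, Field (Kf o) := fun o => @Option.rec I (fun o => Field (Option.elim o k K)) fk (fun j => fK j) o
  letI instN : ∀ o, NumberField (Kf o) := fun o => @Option.rec I (fun o => NumberField (Option.elim o k K)) nk (fun j => nK j) o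
  haveI instC : ∀ o, IsCMField (Kf o) := fun o => @Option.rec I (fun o => IsCMField (Option.elim o k K)) ck (fun j => cK j) o
  obtain ⟨Φ', ι', θ', hA', h0, -⟩ := exists_realisations_cons (Kf := Kf) (i₀ := none) (is := fun m => some (e m)) (T := fun m => A (e m))
    (ΦT := fun m => Φ (e m)) (ιT := fun m => ι (e m)) (θT := fun m => θ (e m)) (Ψ := Ψ) (E := E) (ιE := ιE) (θE := θE) hE (fun m => hA (e m))
  have hΨ' : ∀ σ : Kf none →+* ℂ, σ ∈ (Φ' 0).1 ↔ σ = τ := by rw [h0]; exact hΨ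
  -- the slot map
  let σ : I → Fin (r + 1) := fun x => if h : ∃ m, x = e m then (Classical.choose h).succ else 0
  have hσ : ∀ l, AbelianVariety.IsIsogenous (A (ρ l)) ((Fin.cons E (fun m => A (e m)) : Fin (r + 1) → AbelianVariety ℂ) (σ (ρ l))) := by
    intro l
    by_cases h : ∃ m, ρ l = e m
    · have hs : σ (ρ l) = (Classical.choose h).succ := by simp only [σ, dif_pos h]
      rw [hs, Fin.cons_succ, ← Classical.choose_spec h]
      exact AbelianVariety.IsIsogenous.refl _
    · have hs : σ (ρ l) = 0 := by simp only [σ, dif_neg h]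
      rw [hs, Fin.cons_zero]
      exact hcurve l ((hρ l).resolve_right h)
  have hiso : AbelianVariety.IsIsogenous (⨁ fun l => A (ρ l)) (⨁ fun l => (Fin.cons E (fun m => A (e m)) : Fin (r + 1) → AbelianVariety ℂ) (σ (ρ l))) :=
    AbelianVariety.IsIsogenous.biproduct hσ
  refine Domination.hodgeConjectureFor_of_avDominatedBy ?_ (Domination.AVDominatedBy.of_isIsogenous hiso (Domination.AVDominatedBy.refl _))
  exact hodgeConjectureFor_biproduct_comp_of_simpleThreefolds_of_outside_closures (Kf := Kf) (i₀ := none) (is := fun m => some (e m)) hW4 (fun l => σ (ρ l)) h2 h6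
    i hA' hΨ' (fun m => hS (e m)) hout

/-! ## §2 Any number of such groups, pairwise separated; surfaces (iii′); any curves -/

variable {r : C → ℕ} {kc : C → Type} [∀ c, Field (kc c)] [∀ c, NumberField (kc c)] [∀ c, IsCMField (kc c)]

/-- **MAIN THEOREM — SEPARATED GROUPS OF SIMPLE CM THREEFOLDS, EACH GROUP THROUGH ONE IMAGINARY QUADRATIC FIELD WITH FIELDS PAIRWISE OUTSIDE EACH OTHER'S GALOIS CLOSURES;
SURFACES UP TO THE DIHEDRAL-TRIPLE LIMIT; ANY CURVES — given ONLY Markman's fourfold theorem.**  `A_i ⊨ (K_i; Φ_i)` (`i ∈ I` finite) SIMPLE of dimension `≤ 3`; `b : I → C`; for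
each label `c` the sextic slots of label `c` are among `e_c : Fin r_c → I` with `K_{e_c m} ⊇ i_c m (k_c)` and, for `m₀ ≠ m`, every `τ_c`-embedding of `K_{e_c m}` taking a value
outside the Galois closure of `K_{e_c m₀}`; differently labelled sextic slots SEPARATED; (iii′) among any three quartic slots with one Galois closure two carry isogenous surfaces;
any quadratic slots.  Then the Hodge conjecture holds for every product of copies `⨁_j A_{π j}`.  `HC_CM` is NOT asserted.
[cite: MoonenZarhin1999LowDim, Thm. (0.1), Thm. (0.2), §3 (3.1), Cor. (3.9)] [cite: Markman2025SurveySecant, Thm. 1.2] [cite: Gordon1999HodgeAVSurvey, §3 Theorem (proof), 7.5–7.7, 10.10] -/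
theorem hodgeConjectureFor_prod_of_separatedGroups_of_outside_closures (hW4 : Markman2025_weilClasses_algebraic_abelianFourfold)
    (hA : ∀ i, IsCMTypeRealisation (Φ i) (A i) (ι i) (θ i)) (hS : ∀ i, (A i).IsSimple) (h3 : ∀ i, (A i).dim ≤ 3) (b : I → C)
    (hsep : ∀ t t', Module.finrank ℚ (K t) = 6 → Module.finrank ℚ (K t') = 6 → b t ≠ b t' →
      normalClosure ℚ (K t) ℂ ≠ normalClosure ℚ (K t') ℂ ∧ ¬ ∃ F : IntermediateField ℚ (K t), Module.finrank ℚ F = 2 ∧ IsTotallyComplex F ∧ Nonempty (F →+* K t'))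
    (e : ∀ c, Fin (r c) → I) (h6 : ∀ c m, Module.finrank ℚ (K (e c m)) = 6) (hcov : ∀ t, Module.finrank ℚ (K t) = 6 → ∃ m, t = e (b t) m)
    (h2c : ∀ c, Module.finrank ℚ (kc c) = 2) (i : ∀ c m, kc c →+* K (e c m)) (τ : ∀ c, kc c →+* ℂ)
    (hout : ∀ c (m₀ m : Fin (r c)), m₀ ≠ m → ∀ s : K (e c m) →+* ℂ, s.comp (i c m) = τ c → ∃ x, s x ∉ normalClosure ℚ (K (e c m₀)) ℂ)
    (hS3 : ∀ x y z : I, Module.finrank ℚ (K x) = 4 → Module.finrank ℚ (K y) = 4 → Module.finrank ℚ (K z) = 4 →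
      normalClosure ℚ (K x) ℂ = normalClosure ℚ (K y) ℂ → normalClosure ℚ (K y) ℂ = normalClosure ℚ (K z) ℂ →
      AbelianVariety.IsIsogenous (A x) (A y) ∨ AbelianVariety.IsIsogenous (A x) (A z) ∨ AbelianVariety.IsIsogenous (A y) (A z))
    {N : ℕ} (π : Fin N → I) : HodgeConjectureFor (⨁ fun j => A (π j)).dim (⨁ fun j => A (π j)).X := by
  refine hodgeConjectureFor_prod_of_separatedLabels hA hS h3 b hsep (fun c M ρ hρ => ?_) (fun M ρ hρ => ?_) π
  · -- the block of the label `c`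
    refine hodgeConjectureFor_prod_groupBlock_of_outside_closures hW4 hA hS (e c) (h6 c) (h2c c) (i c) (τ c) (hout c) ρ fun l => ?_
    obtain ⟨t, ht, ⟨g⟩, hbt⟩ := hρ l
    rcases finrank_eq_or_of_dim_le_three₃₅g hA (h3 (ρ l)) with h2 | h4 | h6'
    · -- a curve through `K_t`, `t = e c m`
      obtain ⟨m, htm⟩ := hcov t ht
      refine Or.inl ⟨h2, ?_⟩
      subst hbt
      exact ⟨m, ⟨by rw [← htm]; exact g⟩⟩
    · exfalso
      have h := finrank_dvd_of_ringHom₃₅g g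
      rw [h4, ht] at h
      omega
    · have hb : b (ρ l) = c := (label_eq_of_ringHom_ringHom hA h3 b hsep h6' ht (RingHom.id _) g).trans hbt
      subst hb
      exact Or.inr (hcov (ρ l) h6')
  · exact hodgeConjectureFor_prod_surfaceBlock_of_closures hA hS h3 hS3 ρ fun l h6' => hρ l ⟨ρ l, h6', ⟨RingHom.id _⟩⟩

/-- **Dominated form.** [cite: MoonenZarhin1999LowDim, Thm. (0.1), (0.2)] [cite: Markman2025SurveySecant, Thm. 1.2] [cite: MumfordAV1970, §19 Thm. 1 and p. 169] -/
theorem hodgeConjectureFor_of_avDominatedBy_prod_of_separatedGroups_of_outside_closures (hW4 : Markman2025_weilClasses_algebraic_abelianFourfold)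
    (hA : ∀ i, IsCMTypeRealisation (Φ i) (A i) (ι i) (θ i)) (hS : ∀ i, (A i).IsSimple) (h3 : ∀ i, (A i).dim ≤ 3) (b : I → C)
    (hsep : ∀ t t', Module.finrank ℚ (K t) = 6 → Module.finrank ℚ (K t') = 6 → b t ≠ b t' →
      normalClosure ℚ (K t) ℂ ≠ normalClosure ℚ (K t') ℂ ∧ ¬ ∃ F : IntermediateField ℚ (K t), Module.finrank ℚ F = 2 ∧ IsTotallyComplex F ∧ Nonempty (F →+* K t'))
    (e : ∀ c, Fin (r c) → I) (h6 : ∀ c m, Module.finrank ℚ (K (e c m)) = 6) (hcov : ∀ t, Module.finrank ℚ (K t) = 6 → ∃ m, t = e (b t) m)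
    (h2c : ∀ c, Module.finrank ℚ (kc c) = 2) (i : ∀ c m, kc c →+* K (e c m)) (τ : ∀ c, kc c →+* ℂ)
    (hout : ∀ c (m₀ m : Fin (r c)), m₀ ≠ m → ∀ s : K (e c m) →+* ℂ, s.comp (i c m) = τ c → ∃ x, s x ∉ normalClosure ℚ (K (e c m₀)) ℂ)
    (hS3 : ∀ x y z : I, Module.finrank ℚ (K x) = 4 → Module.finrank ℚ (K y) = 4 → Module.finrank ℚ (K z) = 4 →
      normalClosure ℚ (K x) ℂ = normalClosure ℚ (K y) ℂ → normalClosure ℚ (K y) ℂ = normalClosure ℚ (K z) ℂ →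
      AbelianVariety.IsIsogenous (A x) (A y) ∨ AbelianVariety.IsIsogenous (A x) (A z) ∨ AbelianVariety.IsIsogenous (A y) (A z))
    {N : ℕ} (π : Fin N → I) {X : AbelianVariety ℂ} (hX : Domination.AVDominatedBy X (⨁ fun j => A (π j))) : HodgeConjectureFor X.dim X.X :=
  Domination.hodgeConjectureFor_of_avDominatedBy
    (hodgeConjectureFor_prod_of_separatedGroups_of_outside_closures hW4 hA hS h3 b hsep e h6 hcov h2c i τ hout hS3 π) hX

end Family

end Summit.HodgeConjecture.CorCM.MultiFieldWeil

end
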